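import Summits.Ventures.HSemireg.WedgeWeilSpan

/-!
# Venture HSemireg — THEOREM R-B in the wedge model (2/9)

HONEST FRAMING. Part of the Lean index of the computation cell `pub-hsemireg` (seat p3; Sunday enclosure of the
FORMULA-N kernel assets of seats th-7 / th-6, ENCLOSURE-PLAN-p3.md).  Finite-dimensional exterior algebra over a field ONLY:
no variety, no cohomology theory, no semiregularity map is constructed here; nothing here says that HC / HC_CM / HC_AV holds;
no Literature fact is declared or used.  The geometric DICTIONARY (why these ranks are the `HT`-side box ranks of the cell's
STRUCTURE.md §1 / theory/FORMULA-N.md) lives in theory/FORMULA-N-th7.md PART B §A.3 / §N and is NOT asserted in Lean.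

THEOREM R-B (FORMULA-N PART B §L.3 / §L.8; STRUCTURE D9, (F1) Weil-frame clause, C16) in the SIGN-FREE transposed wedge model — theory/th7/WeilRank.lean v3 sha256/16 7e5d6bad1a94e25a (th-7 g4, 18:46Z; ×2 farm th-2 g20 18:48:20Z); PART R/R2/R3 = l.1506–3436 on top of HankelRank v1 (= the tree's Wedge/WedgeHankel* files), VERBATIM up
to namespaces (`HSemiregWeil` ↦ `Summit.Ventures.HSemireg.Wedge.Weil`, which sees the wedge-model infrastructure `….Wedge` and opens `….Wedge.Hankel`), file 2 of 9.
MODEL: `N` pairs of generators `x_c`, `y_c`; the h-part `f = w_N(q)` (HankelRank); the «Weil vectors» `w₊ = E_{G₋}`, `w₋ = E_{G₊}` = the full monomials on the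
generator blocks of the last `N − p` / first `p` pairs (signature `(p, N − p)`; THEOREM R is `N = 2n`, `p = n`).  HEADLINES (files 5, 8, 9): `weilRank` /
`weilRank_nn` («rank(⌟v ∣ HT²) = (4 + ρ)·n² − 2n», `v = f + a w₊ + b w₋`, `ab ≠ 0`, `n ≥ 3`, ρ = rank H₂(q)), `ker_eq` (kernel = mixed 2-forms killing `f`),
`weilRank_deg` / `weilRank_nn_deg` (every degree `m`, `m + 1 ≤ N − p`), `weilRank_one` / `weilRank_nn_one` (one-sided, ε = 1).  No permutation sign is evaluated
(the pair symmetries act through `AlternatingMap.map_perm`; `sgn κ` is a unit).  This file: pair bookkeeping (`xJ`, `yJ`, `pr`, `pt`), the blocks `Dm p = G₊`, `Gm p = G₋`, the weight `μ`, the support invariants `TrUpTo` / `Wsupp` / `Tr` / `Fsupp` of `w_m(q)` (`f_mem_Sp`).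
-/

open Module Set Set.powersetCard Summit.Ventures.HSemireg.Wedge.Hankel

namespace Summit.Ventures.HSemireg.Wedge.Weil

variable (K : Type*) [Field K]

/-! ### The pair structure of the index set `In N = Fin (N + N)` -/

section Pairs

variable (N : ℕ)

/-- index of the generator `x_c`. -/
def xJ (c : Fin N) : In N := Fin.castAdd N c
/-- index of the generator `y_c`. -/
def yJ (c : Fin N) : In N := Fin.natAdd N c

variable {N}

/-- `x_c` has index `c`. -/
@[simp] lemma xJ_val (c : Fin N) : ((xJ N c : In N) : ℕ) = c := rfl
/-- `y_c` has index `N + c`. -/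
@[simp] lemma yJ_val (c : Fin N) : ((yJ N c : In N) : ℕ) = N + c := rfl

/-- `c ↦ x_c` is injective. -/
lemma xJ_injective : Function.Injective (xJ N) := fun c d h => by
  apply Fin.ext; have := congrArg Fin.val h; simpa using this

/-- `c ↦ y_c` is injective. -/
lemma yJ_injective : Function.Injective (yJ N) := fun c d h => by
  apply Fin.ext; have := congrArg Fin.val h; simp at this; omega

/-- `x_c ≠ y_d`. -/
lemma xJ_ne_yJ (c d : Fin N) : xJ N c ≠ yJ N d := by
  intro h; have := congrArg Fin.val h; simp at this; omega

/-- `x_c = x_d ↔ c = d`. -/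
@[simp] lemma xJ_inj {c d : Fin N} : xJ N c = xJ N d ↔ c = d := xJ_injective.eq_iff
/-- `y_c = y_d ↔ c = d`. -/
@[simp] lemma yJ_inj {c d : Fin N} : yJ N c = yJ N d ↔ c = d := yJ_injective.eq_iff

/-- the pair index of a generator. -/
def pr (i : In N) : Fin N :=
  if h : (i : ℕ) < N then ⟨i, h⟩ else ⟨(i : ℕ) - N, by omega⟩

/-- the pair of `x_c` is `c`. -/
@[simp] lemma pr_xJ (c : Fin N) : pr (xJ N c) = c := by
  unfold pr; rw [dif_pos (by simp)]; ext; rfl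

/-- the pair of `y_c` is `c`. -/
@[simp] lemma pr_yJ (c : Fin N) : pr (yJ N c) = c := by
  unfold pr; rw [dif_neg (by simp)]; ext; simp

/-- every generator is the `x` or the `y` of its pair. -/
lemma eq_xJ_or_eq_yJ (i : In N) : i = xJ N (pr i) ∨ i = yJ N (pr i) := by
  by_cases h : (i : ℕ) < N
  · left; apply Fin.ext; simp [pr, dif_pos h]
  · right; apply Fin.ext; simp [pr, dif_neg h]; omega

/-- the partner generator (`x_c ↔ y_c`). -/
def pt (i : In N) : In N := if (i : ℕ) < N then yJ N (pr i) else xJ N (pr i)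

/-- the partner of `x_c` is `y_c`. -/
@[simp] lemma pt_xJ (c : Fin N) : pt (xJ N c) = yJ N c := by
  unfold pt; rw [if_pos (by simp), pr_xJ]

/-- the partner of `y_c` is `x_c`. -/
@[simp] lemma pt_yJ (c : Fin N) : pt (yJ N c) = xJ N c := by
  unfold pt; rw [if_neg (by simp), pr_yJ]

/-- partners share the pair index. -/
@[simp] lemma pr_pt (i : In N) : pr (pt i) = pr i := by
  rcases eq_xJ_or_eq_yJ i with h | h <;> rw [h] <;> simp

/-- `pt` is an involution. -/
@[simp] lemma pt_pt (i : In N) : pt (pt i) = i := by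
  rcases eq_xJ_or_eq_yJ i with h | h <;> rw [h] <;> simp

/-- no generator is its own partner. -/
lemma pt_ne_self (i : In N) : pt i ≠ i := by
  rcases eq_xJ_or_eq_yJ i with h | h <;> rw [h]
  · simp only [pt_xJ]; exact (xJ_ne_yJ _ _).symm
  · simp only [pt_yJ]; exact xJ_ne_yJ _ _

/-- two generators of the same pair are equal or partners. -/
lemma eq_or_eq_pt_of_pr_eq {i j : In N} (h : pr i = pr j) : j = i ∨ j = pt i := by
  rcases eq_xJ_or_eq_yJ i with hi | hi <;> rcases eq_xJ_or_eq_yJ j with hj | hj <;>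
    rw [hi, hj] <;> simp [h]

/-- a generator that is neither `i` nor `pt i` lies in another pair. -/
lemma pr_ne_of_ne_of_ne_pt {i j : In N} (h1 : j ≠ i) (h2 : j ≠ pt i) : pr i ≠ pr j :=
  fun h => (eq_or_eq_pt_of_pr_eq h).elim h1 h2

/-- HankelRank's `xI m h`, `yI m h` are `xJ ⟨m,h⟩`, `yJ ⟨m,h⟩`. -/
lemma xI_eq_xJ {m : ℕ} (h : m < N) : xI m h = xJ N ⟨m, h⟩ := rfl
/-- HankelRank's `yI m` is `y_⟨m⟩`. -/
lemma yI_eq_yJ {m : ℕ} (h : m < N) : yI m h = yJ N ⟨m, h⟩ := Fin.ext (by simp [yI])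

/-- membership in the first `p` pairs. -/
lemma mem_Dm_iff {p : ℕ} (i : In N) : i ∈ Dm N p ↔ ((pr i : Fin N) : ℕ) < p := by
  rcases eq_xJ_or_eq_yJ i with h | h <;> rw [h]
  · simp only [Dm, Finset.mem_filter, Finset.mem_univ, true_and, xJ_val, pr_xJ]
    constructor
    · rintro (h1 | ⟨h1, _⟩); · exact h1
      · exact absurd h1 (by simp)
    · intro h1; exact Or.inl h1
  · simp only [Dm, Finset.mem_filter, Finset.mem_univ, true_and, yJ_val, pr_yJ]
    omega

/-- `x_c ∈ Dm p ↔ c < p`. -/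
lemma xJ_mem_Dm_iff {p : ℕ} (c : Fin N) : xJ N c ∈ Dm N p ↔ (c : ℕ) < p := by
  rw [mem_Dm_iff, pr_xJ]
/-- `y_c ∈ Dm p ↔ c < p`. -/
lemma yJ_mem_Dm_iff {p : ℕ} (c : Fin N) : yJ N c ∈ Dm N p ↔ (c : ℕ) < p := by
  rw [mem_Dm_iff, pr_yJ]

/-- `Dm p` is closed under partners. -/
lemma pt_mem_Dm_iff {p : ℕ} (i : In N) : pt i ∈ Dm N p ↔ i ∈ Dm N p := by
  rw [mem_Dm_iff, mem_Dm_iff, pr_pt]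

/-- `|Dm m| = 2m` (`m ≤ N`). -/
lemma card_Dm {m : ℕ} (hm : m ≤ N) : (Dm N m).card = m + m := by
  induction m with
  | zero => rw [Dm_zero, Finset.card_empty]
  | succ m ih =>
    have h : m < N := by omega
    have hx : xI m h ∉ insert (yI m h) (Dm N m) := by
      rw [Finset.mem_insert, not_or]; exact ⟨xI_ne_yI h, xI_notMem h⟩
    rw [Dm_succ h, Finset.card_insert_of_notMem hx, Finset.card_insert_of_notMem (yI_notMem h), ih (by omega)]
    omega

variable (N)

/-- the block of the last `N − p` pairs (`G₋`; carries the Weil vector `w₊ = E_{G₋}`). -/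
def Gm (p : ℕ) : Finset (In N) := (Dm N p)ᶜ

variable {N}

/-- membership in `G₋`: pair index `≥ p`. -/
lemma mem_Gm_iff {p : ℕ} (i : In N) : i ∈ Gm N p ↔ p ≤ ((pr i : Fin N) : ℕ) := by
  rw [Gm, Finset.mem_compl, mem_Dm_iff, not_lt]

/-- `G₋` is closed under partners. -/
lemma pt_mem_Gm_iff {p : ℕ} (i : In N) : pt i ∈ Gm N p ↔ i ∈ Gm N p := by
  rw [mem_Gm_iff, mem_Gm_iff, pr_pt]

/-- `|G₋| = 2N − 2p` (`p ≤ N`). -/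
lemma card_Gm {p : ℕ} (hp : p ≤ N) : (Gm N p).card = (N + N) - (p + p) := by
  rw [Gm, Finset.card_compl, card_Dm hp, Fintype.card_fin]

/-- `G₊ = Dm p` and `G₋` are disjoint. -/
lemma disjoint_Dm_Gm (p : ℕ) : Disjoint (Dm N p) (Gm N p) := by
  rw [Gm]; exact disjoint_compl_right

/-- a generator outside `G₊` is in `G₋`. -/
lemma mem_Gm_of_not_mem_Dm {p : ℕ} {i : In N} (h : i ∉ Dm N p) : i ∈ Gm N p := by
  rw [Gm, Finset.mem_compl]; exact h

/-- a generator outside `G₋` is in `G₊`. -/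
lemma mem_Dm_of_not_mem_Gm {p : ℕ} {i : In N} (h : i ∉ Gm N p) : i ∈ Dm N p := by
  rw [Gm, Finset.mem_compl, not_not] at h; exact h

/-- `μ r = |r ∩ G₋|`, the weight used to separate `θ ∧ f`, `θ ∧ w₊`, `θ ∧ w₋`. -/
def μ (p : ℕ) (r : Finset (In N)) : ℕ := (r ∩ Gm N p).card

/-- `μ` is additive on disjoint unions. -/
lemma μ_union {p : ℕ} {s t : Finset (In N)} (h : Disjoint s t) : μ p (s ∪ t) = μ p s + μ p t := by
  rw [μ, μ, μ, Finset.union_inter_distrib_right,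
    Finset.card_union_of_disjoint (Finset.disjoint_of_subset_left Finset.inter_subset_left
      (Finset.disjoint_of_subset_right Finset.inter_subset_left h))]

/-- `μ r ≤ |r|`. -/
lemma μ_le_card {p : ℕ} (s : Finset (In N)) : μ p s ≤ s.card :=
  Finset.card_le_card Finset.inter_subset_left

/-- `μ (G₋) = |G₋|`. -/
lemma μ_Gm (p : ℕ) : μ p (Gm N p) = (Gm N p).card := by
  rw [μ, Finset.inter_self]

/-- `μ (G₊) = 0`. -/
lemma μ_Dm (p : ℕ) : μ p (Dm N p) = 0 := by
  rw [μ, Finset.card_eq_zero, ← Finset.disjoint_iff_inter_eq_empty]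
  exact disjoint_Dm_Gm p

/-- `μ {i} = [i ∈ G₋]`. -/
lemma μ_singleton {p : ℕ} (i : In N) : μ p {i} = if i ∈ Gm N p then 1 else 0 := by
  rw [μ, Finset.singleton_inter]
  split_ifs <;> simp

/-- `xI m ∈ G₋ ↔ p ≤ m`. -/
lemma xI_mem_Gm_iff {p m : ℕ} (h : m < N) : xI m h ∈ Gm N p ↔ p ≤ m := by
  rw [mem_Gm_iff, xI_eq_xJ, pr_xJ]

/-- `yI m ∈ G₋ ↔ p ≤ m`. -/
lemma yI_mem_Gm_iff {p m : ℕ} (h : m < N) : yI m h ∈ Gm N p ↔ p ≤ m := by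
  rw [mem_Gm_iff, yI_eq_yJ, pr_yJ]

/-- transversal sets: exactly one generator of each of the first `m` pairs. -/
def TrUpTo (m : ℕ) (t : Finset (In N)) : Prop := ∀ c : Fin N, (c : ℕ) < m → (xJ N c ∈ t ↔ yJ N c ∉ t)

/-- the support invariant of `w_m(q)`: supported on the first `m` pairs, transversal there, with `μ = m − p`. -/
def Wsupp (p m : ℕ) (t : Finset (In N)) : Prop := t ⊆ Dm N m ∧ TrUpTo m t ∧ μ p t = m - p

/-- the support invariant survives a step `t ↦ t ∪ {x_m}`. -/
lemma Wsupp_insert_x {p m : ℕ} (h : m < N) {t : Finset (In N)} (ht : Wsupp p m t) :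
    Wsupp p (m + 1) (t ∪ {xI m h}) := by
  obtain ⟨h1, h2, h3⟩ := ht
  have hx : xI m h ∉ t := fun hh => xI_notMem h (h1 hh)
  have hy : yI m h ∉ t := fun hh => yI_notMem h (h1 hh)
  refine ⟨?_, ?_, ?_⟩
  · rw [Dm_succ h]
    intro i hi
    rcases Finset.mem_union.mp hi with hi | hi
    · exact Finset.mem_insert_of_mem (Finset.mem_insert_of_mem (h1 hi))
    · rw [Finset.mem_singleton] at hi; rw [hi]; exact Finset.mem_insert_self _ _
  · intro c hc
    simp only [Finset.mem_union, Finset.mem_singleton]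
    by_cases hcm : (c : ℕ) < m
    · have hne1 : xJ N c ≠ xI m h := by rw [xI_eq_xJ]; intro e; rw [xJ_inj] at e; subst e; simp at hcm
      have hne2 : yJ N c ≠ xI m h := by rw [xI_eq_xJ]; exact (xJ_ne_yJ _ _).symm
      simp only [hne1, hne2, or_false]
      exact h2 c hcm
    · have hc' : c = ⟨m, h⟩ := by ext; simp; omega
      subst hc'
      have e1 : xJ N ⟨m, h⟩ = xI m h := rfl
      have e2 : yJ N ⟨m, h⟩ ≠ xI m h := by rw [xI_eq_xJ]; exact (xJ_ne_yJ _ _).symm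
      have e3 : yJ N ⟨m, h⟩ ∉ t := by rw [← yI_eq_yJ]; exact hy
      simp [e1, e2, e3]
  · rw [μ_union (Finset.disjoint_singleton_right.mpr hx), h3, μ_singleton]
    by_cases hh : xI m h ∈ Gm N p
    · rw [if_pos hh]; rw [xI_mem_Gm_iff] at hh; omega
    · rw [if_neg hh]; rw [xI_mem_Gm_iff] at hh; omega

/-- the support invariant survives a step `t ↦ t ∪ {y_m}`. -/
lemma Wsupp_insert_y {p m : ℕ} (h : m < N) {t : Finset (In N)} (ht : Wsupp p m t) :
    Wsupp p (m + 1) (t ∪ {yI m h}) := by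
  obtain ⟨h1, h2, h3⟩ := ht
  have hx : xI m h ∉ t := fun hh => xI_notMem h (h1 hh)
  have hy : yI m h ∉ t := fun hh => yI_notMem h (h1 hh)
  refine ⟨?_, ?_, ?_⟩
  · rw [Dm_succ h]
    intro i hi
    rcases Finset.mem_union.mp hi with hi | hi
    · exact Finset.mem_insert_of_mem (Finset.mem_insert_of_mem (h1 hi))
    · rw [Finset.mem_singleton] at hi; rw [hi]
      exact Finset.mem_insert_of_mem (Finset.mem_insert_self _ _)
  · intro c hc
    simp only [Finset.mem_union, Finset.mem_singleton]
    by_cases hcm : (c : ℕ) < m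
    · have hne1 : xJ N c ≠ yI m h := by rw [yI_eq_yJ]; exact xJ_ne_yJ _ _
      have hne2 : yJ N c ≠ yI m h := by rw [yI_eq_yJ]; intro e; rw [yJ_inj] at e; subst e; simp at hcm
      simp only [hne1, hne2, or_false]
      exact h2 c hcm
    · have hc' : c = ⟨m, h⟩ := by ext; simp; omega
      subst hc'
      have e1 : yJ N ⟨m, h⟩ = yI m h := (yI_eq_yJ h).symm
      have e2 : xJ N ⟨m, h⟩ ≠ yI m h := by rw [yI_eq_yJ]; exact xJ_ne_yJ _ _
      have e3 : xJ N ⟨m, h⟩ ∉ t := hx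
      simp [e1, e2, e3]
  · rw [μ_union (Finset.disjoint_singleton_right.mpr hy), h3, μ_singleton]
    by_cases hh : yI m h ∈ Gm N p
    · rw [if_pos hh]; rw [yI_mem_Gm_iff] at hh; omega
    · rw [if_neg hh]; rw [yI_mem_Gm_iff] at hh; omega

/-- the h-part `f = w_m(q)` is supported on `Wsupp p m`-sets. -/
lemma w_mem_Sp (p : ℕ) {m : ℕ} (hm : m ≤ N) (q : ℕ → K) : w K N m q ∈ Sp K (Wsupp (N := N) p m) := by
  induction m generalizing q with
  | zero =>
    rw [w, ← B_empty K]
    refine Submodule.smul_mem _ _ (B_mem_Sp ⟨by rw [Dm_zero], fun c hc => absurd hc (by omega), ?_⟩)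
    rw [μ, Finset.empty_inter, Finset.card_empty]; omega
  | succ m ih =>
    have h : m < N := by omega
    rw [w, X, Y, dif_pos h, dif_pos h]
    refine Submodule.add_mem _ ?_ ?_
    · exact mul_mem_Sp (P := Wsupp p m) (Q := fun s => s = {xI m h}) (R := Wsupp p (m + 1))
        (fun s t _ hs ht => ht ▸ Wsupp_insert_x h hs) (ih (by omega) q) (B_mem_Sp rfl)
    · exact mul_mem_Sp (P := Wsupp p m) (Q := fun s => s = {yI m h}) (R := Wsupp p (m + 1))
        (fun s t _ hs ht => ht ▸ Wsupp_insert_y h hs) (ih (by omega) (shift K q)) (B_mem_Sp rfl)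

/-- transversal sets of all `N` pairs. -/
def Tr (t : Finset (In N)) : Prop := ∀ i : In N, i ∈ t ↔ pt i ∉ t

/-- a full support set is transversal. -/
lemma tr_of_Wsupp {p : ℕ} {t : Finset (In N)} (ht : Wsupp p N t) : Tr t := by
  intro i
  rcases eq_xJ_or_eq_yJ i with h | h <;> rw [h]
  · rw [pt_xJ]; exact ht.2.1 (pr i) (pr i).isLt
  · rw [pt_yJ, ht.2.1 (pr i) (pr i).isLt, not_not]

/-- the support family of the h-part: transversal with `μ = N − p`. -/
def Fsupp (p : ℕ) (t : Finset (In N)) : Prop := Tr t ∧ μ p t = N - p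

/-- the h-part `f = w_N(q)` is supported on transversal sets of weight `N − p`. -/
lemma f_mem_Sp (p : ℕ) (q : ℕ → K) : w K N N q ∈ Sp K (Fsupp (N := N) p) :=
  Sp_mono (fun _ ht => ⟨tr_of_Wsupp ht, ht.2.2⟩) (w_mem_Sp K p le_rfl q)

end Pairs

end Summit.Ventures.HSemireg.Wedge.Weil
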